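import Mathlib
import HarnessLib
import HarnessLib.Audit
import Summits.PneNP.Statement
import Literature.Computability.FineGrained.FineGrainedWave0
import Literature.Computability.MetaComplexity.Resolution
import HarnessLib.Audit.Status.Attr

/-!
Route: FineGrained

DORMANT since 2026-08-21T17:27:05Z (reconciler: no traction for 5 d (last activity item-proof-filed at 2026-08-16T16:58:42Z); parked, not closed — `ledger route dormant route-PneNP-FineGrained --off` to reactivate) — unstaffed, not closed; items shared with open routes are served there. `ledger route dormant <id> --off` reactivates.

# Route PneNP/FineGrained — "SETH: CNF-SAT has no 2^{(1−ε)n} algorithm; prove it proof-system by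
proof-system"

## Thesis X (it suffices to show)
Words: the Strong Exponential Time Hypothesis — for every ε > 0 some k ≥ 3 has k-SAT (n variables,
deterministic multi-stack TMs, exponents as in ImpagliazzoPaturiJCSS2001 §1) outside
TIME(2^{(1−ε)n}·poly(L)) [CalabroImpagliazzoPaturiIWPEC2009 §1.1]. Fallback thesis X′ = ETH (item
FinegrainedEth: 3-SAT outside TIME(2^{δn}·poly(L)) for some δ > 0), weaker than X by the proved
Literature theorem `eth_of_seth_holds` (EthOfSeth.lean) and still sufficient for PneNP; the deciding
theorem runs through X′, so X closes the route a fortiori.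
Lean: `∀ ε : ℝ, 0 < ε → ∃ k : ℕ, 3 ≤ k ∧ ¬ Literature.Computability.FineGrained.KSATInExpTime k (1 -
ε)`   (= item FinegrainedThesis, rfl-equal to the registered open conjecture
`Literature.Computability.FineGrained.SETH`; X′ = item FinegrainedEth := `∃ δ : ℝ, 0 < δ ∧ ¬
KSATInExpTime 3 δ`, rfl-equal to `Literature.Computability.FineGrained.ETH`; ¬X = item
FinegrainedNotSeth, the self-contained negation. Since rev 7 the conjectures are INLINED as the
route's own items — planner `example : FinegrainedThesis = SETH := rfl` etc., rc 0 — so that no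
`@[conjecture]` leaf is referenced by name in the dependency cone; referenced by name they were
`undeclared-conjecture` deps at rev 6.)

## Deciding theorem X′ → PneNP (rev 7)
`theorem closes (hE : FinegrainedEth) (hA : Assembly2) : _root_.PneNP := hA hE`, with `Assembly2 :=
FinegrainedEth → PneNP` (ETH ⇒ P ≠ NP in Cook's Clay formulation) the assembly the deciding theorem
uses and `Assembly := FinegrainedThesis → PneNP` its X-version twin (SETH ⇒ P ≠ NP; = Assembly2 ∘
eth_of_seth_holds). BOTH are PROVABLE NOW from discharged Literature facts:
`Literature.Computability.FineGrained.P_ne_NP_of_eth_holds` (ETH ⇒ Classes.P ≠ Nondeterministic.NP;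
SatAlgorithmsProofs), `Literature.Computability.Complexity.P_subset_NP_holds`
(NondeterministicProofs) and the model bridges `P_bool_eq_holds` (ClayProblem) / `NP_bool_eq_holds`
(ClayProblemProofs) — if no Cook-NP language lay outside Cook-P then NP ⊆ P ⊆ NP over the prelude
classes, contradicting P ≠ NP (planner scratch ScratchAssembly.lean rc 0, axioms propext /
Classical.choice / Quot.sound; candidate Theorems file AssemblyProof.lean attached as evidence — any
idle prover may land it, importing the three Proofs modules in Theorems/, not here). History: rev 5
carried those bridge facts as HYPOTHESES of two assembly chains and had no deciding theorem; rev 6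
(interim) fed the `_holds` witnesses into `closes` and imported the Proofs modules; rev 7
re-expressed every item over the route's own decls (`workitem set-signature`, meaning-preserving)
and cut the imports to {FineGrainedWave0, Resolution} — Nondeterministic / SatAlgorithms /
ClayProblem (+ the rev-6 Proofs modules) rode in only on the bridge facts and dragged the unproved
named facts NSETH, randSatExponent_four_lt_schoening and NPNotSubsetPPoly into the import cone. Two
assembly-kind items remain (route.multi-assembly) because the gate lets a planner neither drop nor
re-badge an assembly-kind item; both are true and provable now, `Assembly` is the redundant one —
OPERATOR: re-badge it `support` or drop it. needs-fact: NONE (SETH / ETH are the route's own target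
items, not dependencies).

Rationale: WHY THIS LINE. X = SETH is far stronger than P ≠ NP, but it is the one strengthening with a
quantitative, model-by-model ladder on which theorems already sit: SETH-tight size lower bounds hold
for tree-like resolution, for regular and δ-regular resolution [BeckImpagliazzo2013;
BonacinaTalebanfard2017 = doi:10.4230/LIPIcs.IPEC.2015.248, Thm 4 / Cor 6;
`Literature.Computability.FineGrained.regularRes_SETH`] and for bounded-depth Res(⊕)
[EfremenkoGarlikItsykson2024; EfremenkoItsykson2025], while GENERAL resolution is open
(Bonacina2017, Question 8.1, p. 128). Every rung "SETH for proof system Q" is an unconditional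
theorem of k-CNF combinatorics (width, restrictions, xorification, games) with explicit constants,
and every complete SAT algorithm whose transcripts are Q-proofs (DPLL, CDCL = resolution) inherits
it. Imported area: propositional proof complexity; nothing exotic. SETH ⇒ ETH ⇒ P ≠ NP is folklore
(ImpagliazzoPaturiJCSS2001 §1; FominKratsch2010 p. 174) and proved in-tree (`eth_of_seth_holds`,
`P_ne_NP_of_eth_holds`, `P_ne_NP_of_seth_holds`), which is why the deciding theorem runs through the
weaker fallback X′ = ETH: `closes (hE : FinegrainedEth) (hA : Assembly2) : PneNP := hA hE`,
Assembly2 := FinegrainedEth → PneNP being provable now from those discharged facts plus the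
Cook/prelude bridges `P_bool_eq_holds`, `NP_bool_eq_holds`, `P_subset_NP_holds`.

RANKED CRUXES. #0 FinegrainedThesis (target) — X = SETH, inlined (rfl-equal to
`Literature.Computability.FineGrained.SETH`). #2 FinegrainedGeneralResolutionSeth (crux, hardest /
most informative) — SETH for GENERAL dag-like resolution: for every ε > 0 there are k and
unsatisfiable k-CNFs on ≤ n variables all of whose resolution refutations have ≥ 2^{(1−ε)n} lines (=
regularRes_SETH with δ-regularity dropped; why it might fail: open, Bonacina2017 Q8.1 p.128 —
size–width caps general resolution at 2^{(w−k)²/16n}, the xorification amplifier needs δ-regularity,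
free DAG clause reuse (AJPU 2002) might even give 2^{(1−ε₀)n} refutations of every k-CNF; sources
Bonacina2017, BeckImpagliazzo2013, doi:10.4230/LIPIcs.IPEC.2015.248, doi:10.1145/3798129.3800804).
#3 FinegrainedEth (target) — fallback thesis X′ = ETH, inlined (rfl-equal to
`Literature.Computability.FineGrained.ETH`), weaker than X (eth_of_seth_holds) and the hypothesis of
the deciding theorem. #4 FinegrainedNotSeth (crux) — ¬X, the self-contained negation of the inlined
SETH (= ¬FinegrainedThesis on the nose), the negative side staffed deliberately (why it might fail:
SETH may be true — every known k-SAT paradigm has savings only c/k, arXiv:2207.11071 p.3; ¬SETH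
needs one ε for all k on multi-stack TMs and forces E^NP ⊄ linear-size VSP circuits,
arXiv:1805.08554 p.5; sources arXiv:2207.11071, arXiv:1805.08554, arXiv:1601.04743,
CarmosinoEtAlITCS2016). Assemblies: #3 Assembly2 — FinegrainedEth → PneNP (ETH ⇒ P ≠ NP over Cook's
classes; THE assembly of `closes`; elementary from P_ne_NP_of_eth_holds + P_subset_NP_holds +
P_bool_eq_holds + NP_bool_eq_holds, planner scratch rc 0, candidate file attached as evidence) and
#1 Assembly — FinegrainedThesis → PneNP (the X-version twin, = Assembly2 ∘ eth_of_seth_holds;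
redundant, kept only because a planner cannot drop or re-badge an assembly-kind item). Neither crux
feeds the deciding theorem — by design: #2 is the attackable unconditional rung, #4 decides whether
the line runs on X or contracts to X′.

KILL CRITERIA. ¬SETH proved (#4, = #0 refuted; the gate flips the route BROKEN): contract the thesis
to X′ = ETH — drop FinegrainedThesis and the twin Assembly (the deciding theorem uses neither; #4
then stands proved; Assembly becomes vacuously true anyway), keep #2 (independent of SETH's truth).
¬ETH proved (a 2^{δn}·poly 3-SAT algorithm for every δ > 0): close `refuted:FinegrainedEth` — the
deciding theorem's hypothesis is gone and so is X (eth_of_seth_holds). #2 refuted (resolution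
refutations of size 2^{(1−ε₀)n} for all unsatisfiable k-CNFs, all k): close the route — CDCL would
beat SETH-for-resolution and the ladder premise is gone. P ≠ NP proved elsewhere moots the route;
SETH for general resolution proved in print makes #2 `known`.

NOT DECOMPOSED YET. Res(k), polynomial calculus, cutting planes, AC⁰-Frege rungs; the SETH ⇒ OVC /
edit-distance web (`SETHHardness.lean`) is downstream of X, not a route to PneNP; NSETH and the
consequences of refuting it; the constants of the xorification amplifier and the width–size
trade-off (layer-2 children of #2); the explicit step FinegrainedThesis → FinegrainedEth (=
eth_of_seth_holds over the inlined items) is folded into the twin Assembly rather than filed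
separately.

CHEAPEST FALSIFIER. Two lookups: (i) is "SETH for GENERAL resolution" already in print? (the
grounder's page check of BonacinaTalebanfard2017 shows δ-regular only, IPEC 2015 p.1/p.8; newest
rung bounded-depth Res(⊕), EfremenkoGarlikItsykson2024 / doi:10.1145/3798129.3800804) — a positive
hit turns #2 into a Literature fact and removes the route's one attackable crux; (ii) is there a
k-SAT algorithm with savings bounded away from 0 uniformly in k (refutes X; arXiv:2207.11071 p.3:
every known paradigm has savings c/k)?

SOURCES. ImpagliazzoPaturiJCSS2001; CalabroImpagliazzoPaturiIWPEC2009; BonacinaTalebanfard2017;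
Bonacina2017; BeckImpagliazzo2013; EfremenkoGarlikItsykson2024; EfremenkoItsykson2025;
BenSassonWigderson2001; PaturiPudlakSaksZaneJACM2005; FominKratsch2010.

Novelty: Nearest prior art: the "SETH proof-system by proof-system" ladder IS the existing literature line —
tree-like resolution (Pudlák–Impagliazzo 2000), regular resolution BeckImpagliazzo2013, δ-regular
resolution BonacinaTalebanfard2017 (= doi:10.4230/LIPIcs.IPEC.2015.248, Thm 4 / Cor 6; book form
Bonacina2017 ch. 8), bounded-depth Res(⊕) Efremenko–Itsykson doi:10.1145/3798129.3800804 (STOC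
2026). The typed crux FinegrainedGeneralResolutionSeth is verbatim the open Question 8.1 of
Bonacina2017 (p. 128); SETH ⇒ ETH ⇒ P≠NP is folklore (ImpagliazzoPaturiJCSS2001 §1;
CalabroImpagliazzoPaturiIWPEC2009) and already proved in-tree (P_ne_NP_of_seth_holds). Delta: no new
mechanism is claimed — the route packages the open rung as its one attackable crux, keeps ETH as a
typed fallback target with its own assembly, and staffs ¬SETH as the decision item (many expect
¬SETH: MA-analogue false arXiv:1601.04743; consequences of ¬SETH arXiv:1805.08554). Expected grade:
known/variant (value = unconditional rung theorems with explicit constants, inherited by CDCL).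
Searched 2026-08-14: lit search/ --hybrid/vsearch ("Strong ETH regular resolution", "SETH lower bound
k-CNF resolution size"), lit frontier PneNP --since 2020, lit bridges PneNP --cross any, lit galaxy
(pdf, crabby): no SETH-tight size bound for general resolution found; newest rung is bounded-depth
Res(⊕).  [refs: 10.4230/LIPIcs.IPEC.2015.248, 10.1145/3798129.3800804, 1601.04743, 1805.08554, doi:10.4230/LIPIcs.IPEC.2015.248, doi:10.1145/3798129.3800804, BeckImpagliazzo2013, BonacinaTalebanfard2017, Bonacina2017, ImpagliazzoPaturiJCSS2001, CalabroImpagliazzoPaturiIWPEC2009]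

Barriers (technique_class: proof-complexity,resolution-size-lower-bounds,xorification): - Literature.Barriers.PneNP.Relativization: APPLIES at thesis level — X = SETH (fallback ETH)
implies PneNP via the proved facts P_ne_NP_of_seth/_of_eth, so a proof of X composes to a proof of
P≠NP and cannot relativize (SETH fails relative to a PSPACE-complete oracle). NOT evaded: the route
has no mechanism from "SETH for proof system Q" to all algorithms; the bet is only that the rungs
are durable unconditional theorems. The crux (resolution size of a fixed k-CNF family) is a
combinatorial quantity outside the barrier's `blocks` clause.
- Literature.Barriers.PneNP.Algebrization, Literature.Barriers.PneNP.BoundedRelativization: same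
status — bind the thesis-level step, silent on the resolution crux.
- Literature.Barriers.PneNP.NaturalProofs: not met — it blocks P/poly-constructive large properties
useful against P/poly; SETH/ETH are uniform TIME statements and the crux bounds proof size, not
circuit size.
- Literature.Barriers.PneNP.FeasibleInterpolationEF: not met now — interpolation gives resolution
only 2^{n^Ω(1)} bounds; it would bind if the ladder were extended to Frege/EF rungs (deliberately
not decomposed).
- Uncatalogued, technique-internal (the live obstacles for the crux): size–width loses the constant
(2^{(W-k)²/16n}, BT15 p. 2); xorification is SETH-tight only in the xorified variables, ε =
Õ(k^{-1/5}); BT Thm 4 uses δ-regularity essentially; unrestricted DAG clause reuse (AJPU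
regular/general separation) is what no current counting controls.

Novelty grade: known — ROUTE REVIEW (refuter-rreview1-PneNP-FineGrained-3ea08af4-0, rev 8): grade KNOWN (route's own Novelty expects known/variant). Typing: 6/6 rc0; items = SETH / ETH / ¬SETH / (SETH→PneNP) / (ETH→PneNP) by rfl; 0286 = Bonacina2017 Q8.1 verbatim; defs honest (IsResRefutation prefix-indexed & sound; KSATI (refuter refuter-rreview1-PneNP-FineGrained-3ea08af4-0, 2026-08-15T18:26:30Z; prior: ImpagliazzoPaturiJCSS2001, CalabroImpagliazzoPaturiIWPEC2009, BeckImpagliazzo2013, doi:10.4230/LIPIcs.IPEC.2015.248, Bonacina2017, doi:10.1145/3798129.3800804, FominKratsch2010, eccc:TR25-118)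

History (route lifecycle, newest last):
- 2026-08-16T04:14:06Z · AUTO-CRUX (backfill): FinegrainedEth — hypotheses of the deciding theorem that nothing in the route derives are cruxes (operator:999:1085951)
- 2026-08-16T14:43:05Z · LINT AUTOFIX route.multi-assembly: kept Assembly2, dropped Assembly (gate:hygiene)
- 2026-08-21T17:27:05Z · DORMANT — reconciler: no traction for 5 d (last activity item-proof-filed at 2026-08-16T16:58:42Z); parked, not closed — `ledger route dormant route-PneNP-FineGrained --o (operator:999:543118)

sub-problem: PneNP · status: dormant · opened planner-PneNP-Survey-0 2026-08-13T06:08:49Z · rev 9 · ledger route-PneNP-FineGrained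
GENERATED by the gate from the ledger (D-0016/17). Provers cite these decls: `theorem foo : Summit.PneNP.PneNP.Theses.FineGrained.<Decl> := …` in Summits/PneNP/PneNP/Theorems/<Name>.lean.
-/

namespace Summit.PneNP.PneNP.Theses.FineGrained

open scoped BigOperators Topology Manifold Classical MeasureTheory ProbabilityTheory Matrix InnerProductSpace ComplexConjugate ContinuousMap
open Filter Set Function TopologicalSpace MeasureTheory

attribute [summit_statement] _root_.PneNP

open Literature.PNP

/-- item stmt-PneNP-0284 · target · rank 0 · open · by planner
why it might fail: X = SETH may be false (many expect ¬SETH; its MA-analogue fails, arXiv:1601.04743); if true it implies P≠NP (P_ne_NP_of_seth), so no relativizing/algebrizing proof exists, and the route's proof-system rungs bound only algorithms with resolution/Res(⊕) transcripts, never all FinTM2 deciders.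
sources: CalabroImpagliazzoPaturiIWPEC2009, ImpagliazzoPaturiJCSS2001, arXiv:1601.04743, CarmosinoEtAlITCS2016, arXiv:2207.11071 (p.3), Literature.Computability.FineGrained.P_ne_NP_of_seth
Route thesis of PneNP/FineGrained: for every ε > 0 there is k ≥ 3 such that k-SAT is not decidable
in time 2^{(1-ε)n}·poly(size) [ImpagliazzoPaturi2001; CalabroImpagliazzoPaturi2009]. [sources:
ImpagliazzoPaturi2001; CalabroImpagliazzoPaturi2009] [route PneNP/FineGrained, rank 0] -/
@[route_item "route-PneNP-FineGrained"]
def FinegrainedThesis : Prop :=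
  ∀ ε : ℝ, 0 < ε → ∃ k : ℕ, 3 ≤ k ∧ ¬ Literature.Computability.FineGrained.KSATInExpTime k (1 - ε)

/-- item stmt-PneNP-0286 · crux · rank 2 · open · by planner
why it might fail: Open (Bonacina2017 Q8.1, p.128). Size–width caps general resolution at 2^{(w−k)²/16n} ≤ 2^{n/16}; the xorification amplifier (Thm 8.2, p.117) needs δ-regularity via its δn/w term; free DAG clause reuse (AJPU 2002: regular ≢ general) might even give 2^{(1−ε₀)n} refutations of every k-CNF.
sources: book:bonacina2017-space-weak-propositional-proof-systems p.128 Question 8.1; p.116 Thm 8.1, p.117 Def 8.1/Thm 8.2/Cor 8.1, Bonacina2017, BeckImpagliazzo2013, doi:10.4230/LIPIcs.IPEC.2015.248 (Bonacina–Talebanfard IPEC 2015: abstract δ=Õ(k^{-1/5})n, ε_k=Õ(k^{-1/5}); p.2 size–width gives only 2^{(W−k)²/16n}; Thm 4, Cor 6), doi:10.1007/s00453-016-0228-6 (Algorithmica 2017 version), doi:10.1145/3798129.3800804 (Efremenko–Itsykson STOC 2026, SETH for bounded-depth Res(⊕); unheld, acq-00688)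
For every ε > 0 there are k and unsatisfiable k-CNFs on n variables all of whose resolution
refutations have at least 2^{(1-ε)n} clauses for large n. Known for δ-regular resolution
(Beck–Impagliazzo STOC 2013; Bonacina–Talebanfard 2017 =
Literature.Computability.FineGrained.regularRes_SETH) and bounded-depth Res(⊕)
[EfremenkoItsykson2025]; OPEN for general resolution (Bonacina–Talebanfard 2017 §1). Independent of
SETH's truth; hardest and most informative crux (CDCL solvers produce resolution proofs). [sources:
BonacinaTalebanfard2017; STOC2013; EfremenkoItsykson2025; BenSassonWigderson2001] [route
PneNP/FineGrained, rank 2] -/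
@[route_item "route-PneNP-FineGrained"]
def FinegrainedGeneralResolutionSeth : Prop :=
  ∀ ε : ℝ, 0 < ε → ∃ k : ℕ, ∃ φ : ℕ → Literature.Computability.Complexity.CNF ℕ, (∀ n, (φ n).IsWidthLE k ∧ (φ n).numVars ≤ n ∧ ¬ (φ n).Satisfiable) ∧ ∀ᶠ n : ℕ in Filter.atTop, ∀ π : List (Literature.Computability.MetaComplexity.ResLine ℕ), Literature.Computability.MetaComplexity.IsResRefutation (φ n) π → (2 : ℝ) ^ ((1 - ε) * n) ≤ (π.length : ℝ)

/-- item stmt-PneNP-0287 · crux (kind.auto-crux: conjecture-grade) · rank 3 · open · by planner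
why it might fail: ETH may be false: a 2^{o(n)} 3-SAT algorithm is not excluded (only s_3 ≤ 0.387 upper bounds, PPSZ/biased-PPSZ, are known); ETH ⇒ P≠NP (P_ne_NP_of_eth), so any proof is non-relativizing/non-algebrizing; no technique lower-bounds uniform deterministic TIME of 3-SAT. Fallback thesis, not a step.
sources: ImpagliazzoPaturiJCSS2001, ImpagliazzoPaturiZaneJCSS2001, PaturiPudlakSaksZaneJACM2005, arXiv:2207.11071, Literature.Computability.FineGrained.P_ne_NP_of_eth, Literature.Computability.FineGrained.eth_of_seth
Exponential Time Hypothesis [ImpagliazzoPaturi2001]. Weaker than SETH (eth_of_seth) and still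
sufficient: see the companion assembly item finegrained_eth_assembly. [sources:
ImpagliazzoPaturi2001; ImpagliazzoPaturiZane2001] [route PneNP/FineGrained, rank 3] -/
@[route_item "route-PneNP-FineGrained", crux]
def FinegrainedEth : Prop :=
  ∃ δ : ℝ, 0 < δ ∧ ¬ Literature.Computability.FineGrained.KSATInExpTime 3 δ

/-- item stmt-PneNP-0289 · crux · rank 4 · open · by planner
why it might fail: SETH may be true: every known paradigm (PPZ, Schöning, PPSZ, polynomial method) runs in 2^{n(1−c/k+o(1/k))}, c ≤ 1.64 (arXiv:2207.11071 p.3); ¬SETH needs ONE ε for ALL k on multi-stack TMs (FinTM2; word-RAM savings need not transfer) and forces E^NP ⊄ linear-size VSP circuits (arXiv:1805.08554 p.5).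
sources: arXiv:2207.11071 (Scheder, PPSZ is better than you think, p.3: 2^{n(1−c/k+o(1/k))} for all paradigms; SSETH), doi:10.1613/jair.1.11859 (Vyas–Williams, On Super Strong ETH), PaturiPudlakSaksZaneJACM2005, arXiv:1805.08554 (Abboud–Bringmann–Dell–Nederlof p.5: ¬SETH ⇒ E^NP ⊄ linear-size VSP circuits [Wil13, JMV15]; Thm TC1), arXiv:1601.04743 (Williams, MA-analogue of SETH false), CarmosinoEtAlITCS2016
Negative side staffed on purpose: refute SETH (Williams and others conjecture it false;
PPSZ/Schöning give s_k → 1 only [PPSZ2005]). Settling this item decides whether the route runs on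
SETH or contracts to ETH; it does not affect PneNP. [sources: PPSZ2005;
CalabroImpagliazzoPaturi2009] [route PneNP/FineGrained, rank 4] -/
@[route_item "route-PneNP-FineGrained"]
def FinegrainedNotSeth : Prop :=
  ¬ (∀ ε : ℝ, 0 < ε → ∃ k : ℕ, 3 ≤ k ∧ ¬ Literature.Computability.FineGrained.KSATInExpTime k (1 - ε))

/-- item stmt-PneNP-0288 · assembly · rank 3 · closed · proved by Summit.PneNP.PneNP.Theorems.fineGrained_assembly2_proof @ 97b0cd4f142d (prover) · by planner
Fallback assembly for route FineGrained if SETH is refuted: ETH ⇒ CplxCore.P ≠ CplxCore.NP is the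
Literature fact P_ne_NP_of_eth [ImpagliazzoPaturi2001, §1]. [sources: ImpagliazzoPaturi2001] [route
PneNP/FineGrained, rank 3] -/
@[route_item "route-PneNP-FineGrained", crux]
def Assembly2 : Prop :=
  FinegrainedEth → PneNP

-- records of items no longer active in this route (dropped / restated):
-- earlier Assembly (stmt-PneNP-0285, dropped 2026-08-16T14:43:05Z): moot by None — FinegrainedThesis → PneNP

/-! D-0027 §2.1 — DECIDING THEOREM (planner-authored via `route open/edit --closes-file`; by planner-rbadge-PneNP-FineGrained-3ea08af4-g3-0 2026-08-15T17:08:26Z):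
its hypotheses are this route's items and its conclusion the sub-problem Statement (glue_lint), and it elaborates with this file. -/

@[closes "route-PneNP-FineGrained"] theorem closes (hE : FinegrainedEth) (hA : Assembly2) : _root_.PneNP :=
  hA hE

end Summit.PneNP.PneNP.Theses.FineGrained
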